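import Summits.BirchSwinnertonDyer.BirchSwinnertonDyer.Theorems.GenusKolyvaginAtTwoPowDvdShaCardAtTwoRTCrossPairProvenance
import Literature.NumberTheory.EllipticCurves.RootNumber
import HarnessLib

/-!
# Route `GenusKolyvaginAtTwo`, crux L_T `PowDvdShaCardAtTwoRT` (stmt-BirchSwinnertonDyer-23299), LINE 18, road (E4) — the X-ORTH
# ADAPTER, second file: X-ORTH in the PROVENANCE CURRENCY of gk2-p2's capstone frame, and its socket `hOrth` literally

Seat `bsd-line-gk2-p5` g27 (WIDTH-5 attach, SUPPLY lineage, cell `bsd-f1-sign2`), `--supports` the crux L_T (helper; closes nothing).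
THEOREMS ONLY (no definition, no named fact, no `sorry`); BSD is not proved by any of this; neither is L_T nor any stub.

WHY (continuation of `…RTCrossPairProvenance`).  gk2-p2's frame `pow_dvd_natCard_sha_of_kolyvaginSupplies_of_orthogonal` (p737814) records,
for each supplied class `z = 2^{L−e} c_L(n)`, its provenance `(n, d, e)` and the sign of the ELEMENT `z` (`τ_* z = w(E) • z` on the (+)-side,
`−w(E) • z′` on the (−)-side), while the cross-term argument (`…RTCrossPairProvenance` §2) needs the TRUE sign `ε_n` of `c_L(n)` (Gross
Prop. 5.4) on the class that owns the cross places.  The two agree unless `2z = 0`; then `z` is an eigenvector for either sign, the pair is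
swapped, and the level pairing's antisymmetry (Cassels; `ctLevelPairing_eq_zero_of_swap_eq_zero`) finishes — which is why `FrobEqFrobInfty
W K (2^L)` is asked of the primes of BOTH parities.

* §3 `ctLevelPairing_eq_zero_of_kolyvagin_provenance` — both classes with provenance and recorded element signs ⟹ `B_{2^k}(x, x′) = 0`.
* §4 `ctLevelPairing_hOrth_of_kolyvagin_provenance` — the hypothesis `hOrth` of p737814 in its own binder shape, for `B := ctLevelPairing
  (W.baseChange K) (2^k) e …` and `Xp = Xm = FrobEqFrobInfty W K (2^L)`.

What remains for L_T under road (E4) after this file: nothing on the X-ORTH side.  The assembler feeds p737814 with `B := ctLevelPairing …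
(LocalInvariants.canonical K (2^k·2^k)) …` (`hker` = the `→` half of `CasselsTateTotallyComplex.isLevelPairing_ctLevelPairing_canonical`;
`hinvc` = `isConjCompatible_canonical`; `e` from `JET.GlobalDuality.exists_weilPairing_liftEquivariant`), §4 as `hOrth`, KS in Gross currency
with `FrobEqFrobInfty W K (2^L)` exposed on both parities at an EVEN level `L = 2k` (`k ≥ M₀`), and the route's (β″) witness clause.

References: [McCallumLMS1991] §4 Prop. 4.7, §5 Lemma 5.3, Thm. 5.4; [GrossLMS1991] Prop. 5.4, Prop. 6.2; [Cassels1962ArithmeticIV] §1;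
[MilneADT2006] I §6 Prop. 6.9; [Kolyvagin1991StructureSha].
-/

set_option autoImplicit false

noncomputable section

open scoped Classical
open scoped AddSubgroup
open Function Field NumberField IsDedekindDomain WeierstrassCurve
open Literature.NumberTheory.EllipticCurves Literature.NumberTheory.GaloisRepresentations
open Literature.NumberTheory.EllipticCurves.ModularForms
open Literature.NumberTheory.GaloisCohomology
open Literature.NumberTheory.Automorphic
open Summit.BirchSwinnertonDyer.Rank1Residual.X11b.Relaxation
open Summit.BirchSwinnertonDyer.Rank1Residual.JET.GlobalDuality
open Summit.BirchSwinnertonDyer.Rank1Residual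

-- the Theorems namespace of this sub repeats the summit name by design (D-0017 nested layout)
set_option linter.dupNamespace false

namespace Summit.BirchSwinnertonDyer.BirchSwinnertonDyer.Theorems.GenusExact.PlusDescent

variable (W : WeierstrassCurve ℚ) (K : Type) [Field K] [NumberField K] [W.IsElliptic] [W.IsGloballyMinimal]

/-! ## §3 X-ORTH in the capstone's currency: both classes with provenance and RECORDED element signs -/

section Provenance

/-- **X-ORTH IN PROVENANCE CURRENCY** (the socket `hOrth` of gk2-p2's capstone frame, for one pair).  Habitat and pairing data as in
`ctLevelPairing_eq_zero_of_kolyvaginClass_of_opposite_sign`.  Let `z = 2^{L−e₁}•c_L(n)` and `z′ = 2^{L−e₂}•c_L(n′)` (`n, n′` square-free,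
all their primes Zhang–Kolyvagin with `L ≤ M(ℓ)` AND `FrobEqFrobInfty W K (2^L) ℓ`, `e₁, e₂ ≤ k`) be Selmer, locally zero at their own
places, with RECORDED signs `τ_* z = w(E) • z` and `τ_* z′ = −w(E) • z′`.  Then for `x, x′ ∈ Ш(E_K)[2^k]` over `z, z′`: `B_{2^k}(x, x′) = 0`.
Proof: the true sign `ε_n` of `c_L(n)` (Gross Prop. 5.4) equals `w(E)` unless `2z = 0` (`eq_or_two_smul_eq_zero_of_smul_eq_of_smul_eq`);
in the first case §2 applies with `z` first; in the second, `z` is an eigenvector for either sign, §2 applies with `z′` first and the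
pairing is antisymmetric (`ctLevelPairing_eq_zero_of_swap_eq_zero`). [cite: McCallumLMS1991, §4 Prop. 4.7, §5 Lemma 5.3, Thm. 5.4]
[cite: GrossLMS1991, Prop. 5.4, Prop. 6.2 (1)] [cite: Cassels1962ArithmeticIV, §1] [cite: MilneADT2006, Ch. I §6, Prop. 6.9] -/
theorem ctLevelPairing_eq_zero_of_kolyvagin_provenance [NeZero (W.conductorNorm ℤ)]
    (hK : IsImaginaryQuadratic K) (hΔ : W.Δ < 0) (hodd' : Odd (NumberField.discr K)) (hne3 : NumberField.discr K ≠ -3)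
    (hH : SatisfiesHeegnerHypothesis (W.conductorNorm ℤ) K) (hodd : Odd W.tamagawaProduct)
    (hρ2 : W.HasSurjectiveModNGaloisRep 2) {τ : K ≃ₐ[ℚ] K} (hτ1 : τ ≠ 1)
    (Dt : ModularParametrizationData W (W.conductorNorm ℤ)) (β : ℤ) (ι : K →+* ℂ)
    {L k : ℕ} (hLk : L = 2 * k) (hk1 : 1 ≤ k) [NeZero (2 ^ k)] [NeZero (2 ^ k * 2 ^ k)]
    (e : (W.baseChange K).geomTorsion ((2 ^ k * 2 ^ k : ℕ) : ℤ) → (W.baseChange K).geomTorsion ((2 ^ k * 2 ^ k : ℕ) : ℤ) →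
      AlgebraicClosure K)
    (hμ : ∀ S T, e S T ^ (2 ^ k * 2 ^ k) = 1)
    (hadd₁ : ∀ S₁ S₂ T, e (S₁ + S₂) T = e S₁ T * e S₂ T)
    (hadd₂ : ∀ S T₁ T₂, e S (T₁ + T₂) = e S T₁ * e S T₂)
    (hgal : ∀ (γ : absoluteGaloisGroup K) (S T : (W.baseChange K).geomTorsion ((2 ^ k * 2 ^ k : ℕ) : ℤ)),
      γ • e S T = e (γ • S) (γ • T))
    (halt : ∀ T, e T T = 1)
    (hlift : ∀ (σ : K ≃ₐ[ℚ] K) (τ' : AlgebraicClosure K ≃+* AlgebraicClosure K) (hτ' : IsLiftOfAut σ τ')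
      (S T : (W.baseChange K).geomTorsion ((2 ^ k * 2 ^ k : ℕ) : ℤ)),
      τ' (e S T) = e (hτ'.torsionMap W ((2 ^ k * 2 ^ k : ℕ) : ℤ) S) (hτ'.torsionMap W ((2 ^ k * 2 ^ k : ℕ) : ℤ) T))
    (inv : LocalInvariants K (2 ^ k * 2 ^ k)) (hinvc : inv.IsConjCompatible τ) (hPT' : inv.SumInvLocalizationEqZero)
    (hH3 : ∀ c₃ : galoisCohomology (DiscreteGaloisModule.mu K (2 ^ k * 2 ^ k)) 3,
      (∀ v : Place K, galoisCohomology.localization (DiscreteGaloisModule.mu K (2 ^ k * 2 ^ k)) v 3 c₃ = 0) → c₃ = 0)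
    (hfin : ∀ D : GeneralCaseData (W.baseChange K) (2 ^ k) e hμ hadd₁ hadd₂ hgal,
      ∃ S : Finset (Place K), ∀ v ∉ S, D.localTerm inv v = 0)
    -- the (+)-class
    {n : ℕ} (hn : Squarefree n)
    (hKol : ∀ ℓ ∈ n.primeFactors, Zhang2014.IsKolyvaginPrime (W.conductorNorm ℤ) W K 2 ℓ ∧
      L ≤ Zhang2014.kolyvaginIndex W 2 ℓ ∧ FrobEqFrobInfty W K (2 ^ L) ℓ)
    (d : KolyvaginHeegnerData Dt β ι n) {e₁ : ℕ} (he₁ : e₁ ≤ k)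
    (hzS : ((2 ^ (L - e₁) : ℕ) : ℤ) • d.kolyvaginClass Nat.prime_two L ∈ selmerGroup (W.baseChange K) ((2 ^ L : ℕ) : ℤ))
    (hzloc : ∀ ℓ ∈ n.primeFactors, ∀ v : HeightOneSpectrum (𝓞 K), (ℓ : 𝓞 K) ∈ v.asIdeal →
      ((2 ^ (L - e₁) : ℕ) : ℤ) • d.kolyvaginClass Nat.prime_two L ∈
        (W.baseChange K).torsionLocalKer (v.adicCompletion K) ((2 ^ L : ℕ) : ℤ))
    (hzsign : conjAct W τ ((2 ^ L : ℕ) : ℤ) (((2 ^ (L - e₁) : ℕ) : ℤ) • d.kolyvaginClass Nat.prime_two L) =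
      W.rootNumber • (((2 ^ (L - e₁) : ℕ) : ℤ) • d.kolyvaginClass Nat.prime_two L))
    -- the (−)-class
    {n' : ℕ} (hn' : Squarefree n')
    (hKol' : ∀ ℓ ∈ n'.primeFactors, Zhang2014.IsKolyvaginPrime (W.conductorNorm ℤ) W K 2 ℓ ∧
      L ≤ Zhang2014.kolyvaginIndex W 2 ℓ ∧ FrobEqFrobInfty W K (2 ^ L) ℓ)
    (d' : KolyvaginHeegnerData Dt β ι n') {e₂ : ℕ} (he₂ : e₂ ≤ k)
    (hz'S : ((2 ^ (L - e₂) : ℕ) : ℤ) • d'.kolyvaginClass Nat.prime_two L ∈ selmerGroup (W.baseChange K) ((2 ^ L : ℕ) : ℤ))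
    (hz'loc : ∀ ℓ ∈ n'.primeFactors, ∀ v : HeightOneSpectrum (𝓞 K), (ℓ : 𝓞 K) ∈ v.asIdeal →
      ((2 ^ (L - e₂) : ℕ) : ℤ) • d'.kolyvaginClass Nat.prime_two L ∈
        (W.baseChange K).torsionLocalKer (v.adicCompletion K) ((2 ^ L : ℕ) : ℤ))
    (hz'sign : conjAct W τ ((2 ^ L : ℕ) : ℤ) (((2 ^ (L - e₂) : ℕ) : ℤ) • d'.kolyvaginClass Nat.prime_two L) =
      (-W.rootNumber) • (((2 ^ (L - e₂) : ℕ) : ℤ) • d'.kolyvaginClass Nat.prime_two L))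
    -- the Ш-classes over them
    (x x' : ((W.baseChange K).sha)[((2 ^ k : ℕ) : ℤ)])
    (hx : shaTorsionVal (W.baseChange K) (2 ^ k) x =
      torsionH1ToH1 (W.baseChange K) ((2 ^ L : ℕ) : ℤ) (((2 ^ (L - e₁) : ℕ) : ℤ) • d.kolyvaginClass Nat.prime_two L))
    (hx' : shaTorsionVal (W.baseChange K) (2 ^ k) x' =
      torsionH1ToH1 (W.baseChange K) ((2 ^ L : ℕ) : ℤ) (((2 ^ (L - e₂) : ℕ) : ℤ) • d'.kolyvaginClass Nat.prime_two L)) :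
    ctLevelPairing (W.baseChange K) (2 ^ k) e hμ hadd₁ hadd₂ hgal inv halt hPT' hH3 hfin x x' = 0 := by
  have hne4 : NumberField.discr K ≠ -4 := fun h ↦ by
    rw [h] at hodd'
    exact (Int.not_even_iff_odd.mpr hodd') ⟨-2, by norm_num⟩
  have hsurj1 : W.HasSurjectiveModNGaloisRep ((2 : ℤ) ^ 1) := by rwa [pow_one]
  have hL1 : 1 ≤ L := by omega
  have hw : W.rootNumber = 1 ∨ W.rootNumber = -1 := W.rootNumber_eq_one_or
  have hKol₂ : ∀ ℓ ∈ n.primeFactors, Zhang2014.IsKolyvaginPrime (W.conductorNorm ℤ) W K 2 ℓ ∧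
      L ≤ Zhang2014.kolyvaginIndex W 2 ℓ := fun ℓ hℓ ↦ ⟨(hKol ℓ hℓ).1, (hKol ℓ hℓ).2.1⟩
  have hKol₂' : ∀ ℓ ∈ n'.primeFactors, Zhang2014.IsKolyvaginPrime (W.conductorNorm ℤ) W K 2 ℓ ∧
      L ≤ Zhang2014.kolyvaginIndex W 2 ℓ := fun ℓ hℓ ↦ ⟨(hKol' ℓ hℓ).1, (hKol' ℓ hℓ).2.1⟩
  -- the TRUE signs `ε_n`, `ε_{n′}` (Gross Prop. 5.4)
  have hε := KolyvaginClassSign.sign_conjAct_kolyvaginClass_two hK hne3 hne4 hodd' hH hsurj1 τ hτ1 Dt β ι hn hL1 hKol₂ d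
  have hε' := KolyvaginClassSign.sign_conjAct_kolyvaginClass_two hK hne3 hne4 hodd' hH hsurj1 τ hτ1 Dt β ι hn' hL1 hKol₂' d'
  have hzε : conjAct W τ ((2 ^ L : ℕ) : ℤ) (((2 ^ (L - e₁) : ℕ) : ℤ) • d.kolyvaginClass Nat.prime_two L) =
      (-W.rootNumber * (-1) ^ n.primeFactors.card) • (((2 ^ (L - e₁) : ℕ) : ℤ) • d.kolyvaginClass Nat.prime_two L) :=
    conjAct_two_pow_zsmul_kolyvaginClass_eq_sign_smul W K Dt β ι hK hne3 hne4 hodd' hH hsurj1 τ hτ1 hn hL1 hKol₂ d (L - e₁)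
  have hz'ε : conjAct W τ ((2 ^ L : ℕ) : ℤ) (((2 ^ (L - e₂) : ℕ) : ℤ) • d'.kolyvaginClass Nat.prime_two L) =
      (-W.rootNumber * (-1) ^ n'.primeFactors.card) • (((2 ^ (L - e₂) : ℕ) : ℤ) • d'.kolyvaginClass Nat.prime_two L) :=
    conjAct_two_pow_zsmul_kolyvaginClass_eq_sign_smul W K Dt β ι hK hne3 hne4 hodd' hH hsurj1 τ hτ1 hn' hL1 hKol₂' d' (L - e₂)
  -- the level kills the classes: `2^k • z = 0`, `2^k • z′ = 0`
  have hkz : ((2 ^ k : ℕ) : ℤ) • (((2 ^ (L - e₁) : ℕ) : ℤ) • d.kolyvaginClass Nat.prime_two L) = 0 :=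
    two_pow_smul_two_pow_sub_smul_eq_zero hLk he₁ (natCast_level_zsmul_galH1Torsion_eq_zero (W.baseChange K) _)
  have hkz' : ((2 ^ k : ℕ) : ℤ) • (((2 ^ (L - e₂) : ℕ) : ℤ) • d'.kolyvaginClass Nat.prime_two L) = 0 :=
    two_pow_smul_two_pow_sub_smul_eq_zero hLk he₂ (natCast_level_zsmul_galH1Torsion_eq_zero (W.baseChange K) _)
  -- dichotomy on the (+)-class: true sign `= w(E)`, or `2 z = 0`
  rcases eq_or_two_smul_eq_zero_of_smul_eq_of_smul_eq hw hε.1 hzsign hzε with hεw | h2z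
  · -- `ε_n = w(E)`: `z` first, `z′` is `(−ε_n)`-eigen by its recorded sign
    refine ctLevelPairing_eq_zero_of_kolyvaginClass_of_opposite_sign W K hK hΔ hodd' hne3 hH hodd hρ2 hτ1 Dt β ι hLk hk1 e hμ hadd₁
      hadd₂ hgal halt hlift inv hinvc hPT' hH3 hfin hn hKol d he₁ hzS hzloc hz'S hkz' hn' hKol₂' hz'loc ?_ x x' hx hx'
    rw [hεw]
    exact hz'sign.trans (neg_zsmul _ _)
  · -- `2 z = 0`: swap the pair; `z′` first, `z` is `(−ε_{n′})`-eigen because it is `2`-torsion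
    refine ctLevelPairing_eq_zero_of_swap_eq_zero (W.baseChange K) (2 ^ k) e hμ hadd₁ hadd₂ hgal inv halt hPT' hH3 hfin ?_
    refine ctLevelPairing_eq_zero_of_kolyvaginClass_of_opposite_sign W K hK hΔ hodd' hne3 hH hodd hρ2 hτ1 Dt β ι hLk hk1 e hμ hadd₁
      hadd₂ hgal halt hlift inv hinvc hPT' hH3 hfin hn' hKol' d' he₂ hz'S hz'loc hzS hkz hn hKol₂ hzloc ?_ x' x hx' hx
    have hnegε : -(-W.rootNumber * (-1) ^ n'.primeFactors.card) = 1 ∨ -(-W.rootNumber * (-1) ^ n'.primeFactors.card) = -1 := by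
      rcases hε'.1 with h | h <;> rw [h] <;> norm_num
    exact (smul_eq_of_smul_eq_of_two_smul_eq_zero hw hnegε hzsign h2z).trans (neg_zsmul _ _)

/-! ## §4 The socket `hOrth` of the capstone frame, literally -/

/-- **THE SOCKET `hOrth` OF gk2-p2's CAPSTONE FRAME, DISCHARGED** for `B := ctLevelPairing (W.baseChange K) (2^k) e …` and the prime
predicates `Xp = Xm = FrobEqFrobInfty W K (2^L)`: the hypothesis `hOrth` of `pow_dvd_natCard_sha_of_kolyvaginSupplies_of_orthogonal`
(`…RTOrthogonalCapstoneFrame`, p737814) in its own binder shape — for all `x x′ ∈ Ш(E_K)[2^k]`, (+)-provenance of `x` and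
(−)-provenance of `x′` imply `B x x′ = 0`.  Habitat: `W/ℚ` globally minimal, `Δ < 0`, odd Tamagawa product, `ρ̄_{E,2}` onto; `K` imaginary
quadratic with `d_K` odd `≠ −3`, Heegner for `N_W`; `τ ≠ 1`; `L = 2k`, `k ≥ 1`; `e` a Weil datum on `E[2^L]` equivariant under every lift of
every `σ ∈ Aut(K/ℚ)` (`JET.GlobalDuality.exists_weilPairing_liftEquivariant`); `inv` conj-compatible with reciprocity, `Ш³ = 0` and finite
support (e.g. `LocalInvariants.canonical`). [cite: McCallumLMS1991, §4 Prop. 4.7, §5 Lemma 5.3, Thm. 5.4] [cite: GrossLMS1991, Prop. 5.4, Prop. 6.2]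
[cite: Cassels1962ArithmeticIV, §1] [cite: MilneADT2006, Ch. I §6, Prop. 6.9] -/
theorem ctLevelPairing_hOrth_of_kolyvagin_provenance [NeZero (W.conductorNorm ℤ)]
    (hK : IsImaginaryQuadratic K) (hΔ : W.Δ < 0) (hodd' : Odd (NumberField.discr K)) (hne3 : NumberField.discr K ≠ -3)
    (hH : SatisfiesHeegnerHypothesis (W.conductorNorm ℤ) K) (hodd : Odd W.tamagawaProduct)
    (hρ2 : W.HasSurjectiveModNGaloisRep 2) (τ : K ≃ₐ[ℚ] K) (hτ1 : τ ≠ 1)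
    (Dt : ModularParametrizationData W (W.conductorNorm ℤ)) (β : ℤ) (ι : K →+* ℂ)
    (L k : ℕ) (hLk : L = 2 * k) (hk1 : 1 ≤ k) [NeZero (2 ^ k)] [NeZero (2 ^ k * 2 ^ k)]
    (e : (W.baseChange K).geomTorsion ((2 ^ k * 2 ^ k : ℕ) : ℤ) → (W.baseChange K).geomTorsion ((2 ^ k * 2 ^ k : ℕ) : ℤ) →
      AlgebraicClosure K)
    (hμ : ∀ S T, e S T ^ (2 ^ k * 2 ^ k) = 1)
    (hadd₁ : ∀ S₁ S₂ T, e (S₁ + S₂) T = e S₁ T * e S₂ T)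
    (hadd₂ : ∀ S T₁ T₂, e S (T₁ + T₂) = e S T₁ * e S T₂)
    (hgal : ∀ (γ : absoluteGaloisGroup K) (S T : (W.baseChange K).geomTorsion ((2 ^ k * 2 ^ k : ℕ) : ℤ)),
      γ • e S T = e (γ • S) (γ • T))
    (halt : ∀ T, e T T = 1)
    (hlift : ∀ (σ : K ≃ₐ[ℚ] K) (τ' : AlgebraicClosure K ≃+* AlgebraicClosure K) (hτ' : IsLiftOfAut σ τ')
      (S T : (W.baseChange K).geomTorsion ((2 ^ k * 2 ^ k : ℕ) : ℤ)),
      τ' (e S T) = e (hτ'.torsionMap W ((2 ^ k * 2 ^ k : ℕ) : ℤ) S) (hτ'.torsionMap W ((2 ^ k * 2 ^ k : ℕ) : ℤ) T))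
    (inv : LocalInvariants K (2 ^ k * 2 ^ k)) (hinvc : inv.IsConjCompatible τ) (hPT' : inv.SumInvLocalizationEqZero)
    (hH3 : ∀ c₃ : galoisCohomology (DiscreteGaloisModule.mu K (2 ^ k * 2 ^ k)) 3,
      (∀ v : Place K, galoisCohomology.localization (DiscreteGaloisModule.mu K (2 ^ k * 2 ^ k)) v 3 c₃ = 0) → c₃ = 0)
    (hfin : ∀ D : GeneralCaseData (W.baseChange K) (2 ^ k) e hμ hadd₁ hadd₂ hgal,
      ∃ S : Finset (Place K), ∀ v ∉ S, D.localTerm inv v = 0) :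
    ∀ x x' : ↥((↥(W.baseChange K).sha)[((2 ^ k : ℕ) : ℤ)]),
      (∃ (n : ℕ) (d : KolyvaginHeegnerData Dt β ι n) (e : ℕ), Squarefree n ∧
        (∀ ℓ ∈ n.primeFactors, Zhang2014.IsKolyvaginPrime (W.conductorNorm ℤ) W K 2 ℓ ∧ L ≤ Zhang2014.kolyvaginIndex W 2 ℓ ∧
          FrobEqFrobInfty W K (2 ^ L) ℓ) ∧
        e ≤ k ∧
        ((2 ^ (L - e) : ℕ) : ℤ) • d.kolyvaginClass Nat.prime_two L ∈ selmerGroup (W.baseChange K) ((2 ^ L : ℕ) : ℤ) ∧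
        (∀ ℓ ∈ n.primeFactors, ∀ v : HeightOneSpectrum (𝓞 K), ((ℓ : ℕ) : 𝓞 K) ∈ v.asIdeal →
          ((2 ^ (L - e) : ℕ) : ℤ) • d.kolyvaginClass Nat.prime_two L ∈
            (W.baseChange K).torsionLocalKer (v.adicCompletion K) ((2 ^ L : ℕ) : ℤ)) ∧
        conjAct W τ ((2 ^ L : ℕ) : ℤ) (((2 ^ (L - e) : ℕ) : ℤ) • d.kolyvaginClass Nat.prime_two L) =
          W.rootNumber • (((2 ^ (L - e) : ℕ) : ℤ) • d.kolyvaginClass Nat.prime_two L) ∧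
        ((x : (W.baseChange K).sha) : (W.baseChange K).galH1) =
          torsionH1ToH1 (W.baseChange K) ((2 ^ L : ℕ) : ℤ) (((2 ^ (L - e) : ℕ) : ℤ) • d.kolyvaginClass Nat.prime_two L)) →
      (∃ (n : ℕ) (d : KolyvaginHeegnerData Dt β ι n) (e : ℕ), Squarefree n ∧
        (∀ ℓ ∈ n.primeFactors, Zhang2014.IsKolyvaginPrime (W.conductorNorm ℤ) W K 2 ℓ ∧ L ≤ Zhang2014.kolyvaginIndex W 2 ℓ ∧
          FrobEqFrobInfty W K (2 ^ L) ℓ) ∧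
        e ≤ k ∧
        ((2 ^ (L - e) : ℕ) : ℤ) • d.kolyvaginClass Nat.prime_two L ∈ selmerGroup (W.baseChange K) ((2 ^ L : ℕ) : ℤ) ∧
        (∀ ℓ ∈ n.primeFactors, ∀ v : HeightOneSpectrum (𝓞 K), ((ℓ : ℕ) : 𝓞 K) ∈ v.asIdeal →
          ((2 ^ (L - e) : ℕ) : ℤ) • d.kolyvaginClass Nat.prime_two L ∈
            (W.baseChange K).torsionLocalKer (v.adicCompletion K) ((2 ^ L : ℕ) : ℤ)) ∧
        conjAct W τ ((2 ^ L : ℕ) : ℤ) (((2 ^ (L - e) : ℕ) : ℤ) • d.kolyvaginClass Nat.prime_two L) =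
          (-W.rootNumber) • (((2 ^ (L - e) : ℕ) : ℤ) • d.kolyvaginClass Nat.prime_two L) ∧
        ((x' : (W.baseChange K).sha) : (W.baseChange K).galH1) =
          torsionH1ToH1 (W.baseChange K) ((2 ^ L : ℕ) : ℤ) (((2 ^ (L - e) : ℕ) : ℤ) • d.kolyvaginClass Nat.prime_two L)) →
      ctLevelPairing (W.baseChange K) (2 ^ k) e hμ hadd₁ hadd₂ hgal inv halt hPT' hH3 hfin x x' = 0 := by
  rintro x x' ⟨n, d, e₁, hn, hKol, he₁, hzS, hzloc, hzsign, hx⟩ ⟨n', d', e₂, hn', hKol', he₂, hz'S, hz'loc, hz'sign, hx'⟩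
  exact ctLevelPairing_eq_zero_of_kolyvagin_provenance W K hK hΔ hodd' hne3 hH hodd hρ2 hτ1 Dt β ι hLk hk1 e hμ hadd₁ hadd₂ hgal
    halt hlift inv hinvc hPT' hH3 hfin hn hKol d he₁ hzS hzloc hzsign hn' hKol' d' he₂ hz'S hz'loc hz'sign x x' hx hx'

end Provenance

end Summit.BirchSwinnertonDyer.BirchSwinnertonDyer.Theorems.GenusExact.PlusDescent

end
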